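import Mathlib
import Literature.NumberTheory.Sieve.FriedlanderIwaniecPrimesCutoffSeparation
import Literature.NumberTheory.Sieve.FriedlanderIwaniecPrimesKubotaBilinear

/-!
# Route `FordMaynardSieveConst01651`, target `SieveConst01651` (stmt-Parity-19185), line `sieve_decomposition`:
# helpers towards `stub_typeIIRegion` — Ford–Maynard Lemmas 7.9 / 7.13 as `BilinBoundedBy` transformers

Ford–Maynard, arXiv:2407.14368v1, §7.1: **Lemma 7.9** (separation of variables in an inequality
`f(n) > g(m)` at the cost of a factor `log x`, "frequently … one of `f(n), g(m)` is integer valued, and the other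
… is always `½` plus an integer, from which it follows that `|f(n) − g(m)| ≥ ½`") and **Lemma 7.13** (removing box
conditions `∏_{j∈J} n_j > y` / `≤ y`, each at the cost of a factor `log x`).  In the bilinear endgame of
Proposition 7.22 these are applied to forms with `1`-bounded coefficients, i.e. to the tree's predicate
`FriedlanderIwaniecPrimes.BilinBoundedBy` — whose PROVED transformers `.threshold'` (Friedlander–Iwaniec §20–21,
trapezoid Fourier transform) and `.cutoff` (Lemma 26.1) are exactly these devices.  This file packages the two
forms Ford–Maynard use:
* `bilin_threshold_nat` — Lemma 7.9 for natural-number valued `f ≤ N` on `W` and `g ≤ N` on `Z`: the condition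
  `[g(z) < f(w)]` costs `3(1 + log(2N + 2))`;
* `bilin_cutoff_compl` — Lemma 7.13's complementary box condition `[u(w) v(z) > y]` costs `1 + log 6y`.
Together with `bilinBoundedBy_of_typeII` (…TypeIIBilin: (II) ⇒ `BilinBoundedBy`) this is the (t5) plumbing of
the Prop 7.19 programme at `P = (1/2, 0, ν)`.  Def-free. Nothing here proves anything about the Parity summit.
-/

open Finset Literature.NumberTheory.Sieve.FriedlanderIwaniecPrimes

namespace Summit.Parity.GeneralizedHardyLittlewood.FordMaynardSieveConst01651SieveConst01651

variable {ι κ : Type*}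

/-- **Ford–Maynard Lemma 7.9, integer thresholds, in `BilinBoundedBy` form.** If every bilinear form in the
kernel `K` over `W × Z` with `1`-bounded coefficients is `≤ X`, and `f ≤ N` on `W`, `g ≤ N` on `Z` are
natural-number valued, then every bilinear form in the kernel `[g(z) < f(w)] K(w, z)` with `1`-bounded
coefficients is `≤ 3(1 + log(2N + 2)) X` (apply the tree's `BilinBoundedBy.threshold'` to `A(z) = g(z) + ½`,
`B(w) = f(w)`: `½ ≤ |A − B| ≤ N + ½`). [cite: FordMaynard2024PrimeSieves, Lemma 7.9 (and the remark after it)] -/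
theorem bilin_threshold_nat {K : ι → κ → ℂ} {W : Finset ι} {Z : Finset κ} {X : ℝ}
    (h : BilinBoundedBy K W Z X) (f : ι → ℕ) (g : κ → ℕ) {N : ℕ} (hf : ∀ w ∈ W, f w ≤ N)
    (hg : ∀ z ∈ Z, g z ≤ N) :
    BilinBoundedBy (fun w z => (if g z < f w then (1 : ℂ) else 0) * K w z) W Z
      (3 * (1 + Real.log (2 * N + 2)) * X) := by
  have hR : (1 : ℝ) ≤ 2 * N + 2 := by
    have : (0 : ℝ) ≤ N := Nat.cast_nonneg _
    linarith
  have h' := h.threshold' (A := fun z => (g z : ℝ) + 1 / 2) (B := fun w => (f w : ℝ)) hR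
    (fun w _ z _ => by
      -- `|g + ½ − f| ≥ ½ ≥ 1/(2N+2)` for integers `f, g`
      have hhalf : (1 : ℝ) / 2 ≤ |((g z : ℝ) + 1 / 2) - (f w : ℝ)| := by
        rcases le_or_gt (f w) (g z) with hle | hlt
        · have : (f w : ℝ) ≤ g z := by exact_mod_cast hle
          rw [abs_of_nonneg (by linarith)]; linarith
        · have : (g z : ℝ) + 1 ≤ f w := by exact_mod_cast hlt
          rw [abs_of_neg (by linarith)]; linarith
      refine le_trans ?_ hhalf
      rw [div_le_div_iff₀ (by linarith) (by norm_num)]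
      linarith)
    (fun w hw z hz => by
      have h1 : (f w : ℝ) ≤ N := by exact_mod_cast hf w hw
      have h2 : (g z : ℝ) ≤ N := by exact_mod_cast hg z hz
      have h3 : (0 : ℝ) ≤ f w := Nat.cast_nonneg _
      have h4 : (0 : ℝ) ≤ g z := Nat.cast_nonneg _
      rw [abs_le]; constructor <;> linarith)
  refine h'.congr fun w _ z _ => ?_
  -- `g + ½ < f` over `ℝ` iff `g < f` over `ℕ`
  congr 2
  refine propext ⟨fun hlt => ?_, fun hlt => ?_⟩
  · by_contra hle
    push Not at hle
    have : (f w : ℝ) ≤ g z := by exact_mod_cast hle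
    have hlt' : (g z : ℝ) + 1 / 2 < f w := hlt
    linarith
  · have : (g z : ℝ) + 1 ≤ f w := by exact_mod_cast hlt
    show (g z : ℝ) + 1 / 2 < f w
    linarith

/-- **Ford–Maynard Lemma 7.13 (a box condition `∏ > y`), in `BilinBoundedBy` form.** If every bilinear form in
`K` over `W × Z` with `1`-bounded coefficients is `≤ X`, `u ≥ 1` on `W`, `v ≥ 1` on `Z`, `y ≥ 1`, then every
bilinear form in the kernel `[u(w) v(z) > y] K(w, z)` is `≤ (1 + log 6y) X` (complement of the tree's
`BilinBoundedBy.cutoff`, Lemma 26.1 of Friedlander–Iwaniec). [cite: FordMaynard2024PrimeSieves, Lemma 7.13] -/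
theorem bilin_cutoff_compl {K : ι → κ → ℂ} {W : Finset ι} {Z : Finset κ} {X : ℝ}
    (h : BilinBoundedBy K W Z X) {u : ι → ℕ} {v : κ → ℕ} (hu : ∀ w ∈ W, 1 ≤ u w)
    (hv : ∀ z ∈ Z, 1 ≤ v z) {y : ℝ} (hy : 1 ≤ y) :
    BilinBoundedBy (fun w z => (if y < ((u w * v z : ℕ) : ℝ) then (1 : ℂ) else 0) * K w z) W Z
      ((1 + Real.log (6 * y)) * X) := by
  have hsum := h.add ((h.cutoff hu hv hy).const_mul (-1))
  have hX0 : 0 ≤ X := h.nonneg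
  refine (hsum.congr fun w _ z _ => ?_).mono (le_of_eq ?_)
  · by_cases hle : ((u w * v z : ℕ) : ℝ) ≤ y
    · rw [if_pos hle, if_neg (not_lt.mpr hle)]; ring
    · rw [if_neg hle, if_pos (not_le.mp hle)]; ring
  · rw [norm_neg, norm_one]; ring

end Summit.Parity.GeneralizedHardyLittlewood.FordMaynardSieveConst01651SieveConst01651

namespace Summit.Parity.GeneralizedHardyLittlewood.FordMaynardSieveConst01651SieveConst01651

/-! ### Appended: the other threshold direction, non-strict thresholds, and one-variable indicator twists -/

variable {ι κ : Type*}

/-- **Lemma 7.9, integer thresholds, direction `[f(w) < g(z)]`** (via the tree's `BilinBoundedBy.threshold`):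
`f ≤ N` on `W`, `g ≤ N` on `Z` natural-valued ⇒ the kernel `[f(w) < g(z)] K` is bounded by `3(1 + log(2N+2)) X`.
[cite: FordMaynard2024PrimeSieves, Lemma 7.9] -/
theorem bilin_threshold_nat' {K : ι → κ → ℂ} {W : Finset ι} {Z : Finset κ} {X : ℝ}
    (h : BilinBoundedBy K W Z X) (f : ι → ℕ) (g : κ → ℕ) {N : ℕ} (hf : ∀ w ∈ W, f w ≤ N)
    (hg : ∀ z ∈ Z, g z ≤ N) :
    BilinBoundedBy (fun w z => (if f w < g z then (1 : ℂ) else 0) * K w z) W Z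
      (3 * (1 + Real.log (2 * N + 2)) * X) := by
  have hR : (1 : ℝ) ≤ 2 * N + 2 := by
    have : (0 : ℝ) ≤ N := Nat.cast_nonneg _
    linarith
  have h' := h.threshold (A := fun z => (g z : ℝ)) (B := fun w => (f w : ℝ) + 1 / 2) hR
    (fun w _ z _ => by
      have hhalf : (1 : ℝ) / 2 ≤ |(g z : ℝ) - ((f w : ℝ) + 1 / 2)| := by
        rcases le_or_gt (g z) (f w) with hle | hlt
        · have : (g z : ℝ) ≤ f w := by exact_mod_cast hle
          rw [abs_of_neg (by linarith)]; linarith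
        · have : (f w : ℝ) + 1 ≤ g z := by exact_mod_cast hlt
          rw [abs_of_nonneg (by linarith)]; linarith
      refine le_trans ?_ hhalf
      rw [div_le_div_iff₀ (by linarith) (by norm_num)]
      linarith)
    (fun w hw z hz => by
      have h1 : (f w : ℝ) ≤ N := by exact_mod_cast hf w hw
      have h2 : (g z : ℝ) ≤ N := by exact_mod_cast hg z hz
      have h3 : (0 : ℝ) ≤ f w := Nat.cast_nonneg _
      have h4 : (0 : ℝ) ≤ g z := Nat.cast_nonneg _
      rw [abs_le]; constructor <;> linarith)
  refine h'.congr fun w _ z _ => ?_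
  congr 2
  refine propext ⟨fun hlt => ?_, fun hlt => ?_⟩
  · by_contra hle
    push Not at hle
    have : (g z : ℝ) ≤ f w := by exact_mod_cast hle
    have hlt' : (f w : ℝ) + 1 / 2 < g z := hlt
    linarith
  · have : (f w : ℝ) + 1 ≤ g z := by exact_mod_cast hlt
    show (f w : ℝ) + 1 / 2 < g z
    linarith

/-- Non-strict integer threshold `[g(z) ≤ f(w)]` (= `[g(z) < f(w) + 1]`), cost `3(1 + log(2N+4))`.
[cite: FordMaynard2024PrimeSieves, Lemma 7.9] -/
theorem bilin_threshold_nat_le {K : ι → κ → ℂ} {W : Finset ι} {Z : Finset κ} {X : ℝ}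
    (h : BilinBoundedBy K W Z X) (f : ι → ℕ) (g : κ → ℕ) {N : ℕ} (hf : ∀ w ∈ W, f w ≤ N)
    (hg : ∀ z ∈ Z, g z ≤ N) :
    BilinBoundedBy (fun w z => (if g z ≤ f w then (1 : ℂ) else 0) * K w z) W Z
      (3 * (1 + Real.log (2 * (N + 1 : ℕ) + 2)) * X) := by
  have h' := bilin_threshold_nat h (fun w => f w + 1) g (N := N + 1) (fun w hw => by have := hf w hw; omega)
    (fun z hz => by have := hg z hz; omega)
  refine h'.congr fun w _ z _ => ?_
  simp only [Nat.lt_succ_iff]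

/-- Non-strict integer threshold `[f(w) ≤ g(z)]`, cost `3(1 + log(2N+4))`. [cite: FordMaynard2024PrimeSieves, Lemma 7.9] -/
theorem bilin_threshold_nat_le' {K : ι → κ → ℂ} {W : Finset ι} {Z : Finset κ} {X : ℝ}
    (h : BilinBoundedBy K W Z X) (f : ι → ℕ) (g : κ → ℕ) {N : ℕ} (hf : ∀ w ∈ W, f w ≤ N)
    (hg : ∀ z ∈ Z, g z ≤ N) :
    BilinBoundedBy (fun w z => (if f w ≤ g z then (1 : ℂ) else 0) * K w z) W Z
      (3 * (1 + Real.log (2 * (N + 1 : ℕ) + 2)) * X) := by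
  have h' := bilin_threshold_nat' h f (fun z => g z + 1) (N := N + 1) (fun w hw => by have := hf w hw; omega)
    (fun z hz => by have := hg z hz; omega)
  refine h'.congr fun w _ z _ => ?_
  simp only [Nat.lt_succ_iff]

/-- One-variable conditions are free: the kernel `[P(w)] [Q(z)] K` has the same bound (absorb the indicators into
the coefficients; the tree's `BilinBoundedBy.twist`). [cite: FordMaynard2024PrimeSieves, §7.3 ("which can be absorbed into the 1-bounded functions")] -/
theorem bilin_indicator_twist {K : ι → κ → ℂ} {W : Finset ι} {Z : Finset κ} {X : ℝ}
    (h : BilinBoundedBy K W Z X) (P : ι → Prop) (Q : κ → Prop) [DecidablePred P] [DecidablePred Q] :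
    BilinBoundedBy (fun w z => (if P w then (1 : ℂ) else 0) * (if Q z then (1 : ℂ) else 0) * K w z) W Z X :=
  h.twist (fun w => if P w then (1 : ℂ) else 0) (fun z => if Q z then (1 : ℂ) else 0)
    (fun w => by split_ifs <;> simp) (fun z => by split_ifs <;> simp)

end Summit.Parity.GeneralizedHardyLittlewood.FordMaynardSieveConst01651SieveConst01651
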